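import Mathlib
import Summits.KontsevichZagierPeriods.KontsevichZagierPeriods.Theorems.InverseLandauTateFamilyKernelOpenCube
import Summits.KontsevichZagierPeriods.KontsevichZagierPeriods.Theorems.InverseLandauTateFamilyKernelTateAnchor
import Summits.KontsevichZagierPeriods.KontsevichZagierPeriods.Theorems.InverseLandauTateFamilyKernelStubExactFibreTwo
import Summits.KontsevichZagierPeriods.KontsevichZagierPeriods.Theorems.InverseLandauTateFamilyKernelStubGpMoments
import Summits.KontsevichZagierPeriods.KontsevichZagierPeriods.Theorems.InverseLandauTateFamilyKernelStubGpDensity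
import Summits.KontsevichZagierPeriods.KontsevichZagierPeriods.Theorems.InverseLandauTateFamilyKernelStubGpPolyIntegral
import Summits.KontsevichZagierPeriods.KontsevichZagierPeriods.Theorems.InverseLandauTateFamilyKernelStubGpDivision
import Summits.KontsevichZagierPeriods.KontsevichZagierPeriods.Theorems.InverseLandauTateFamilyKernelStubGpCertificate

/-!
# Crux `TateFamilyKernel` (stmt-KontsevichZagierPeriods-9130), line `Sketch` — the GRAPH-PENCIL CLASS is a
proved sector (glue `gpClass_mem_relations`)

The graph-pencil class of the lead's skeleton of the crux
`Summit.KontsevichZagierPeriods.KontsevichZagierPeriods.Theses.InverseLandau.TateFamilyKernel`: Tate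
denominator `Q = 1 − ϖ·(u(z₂) + βz₁)` with `u ∈ ℚ[s]` positive and strictly increasing on `[0,1]` (any
degree), `0 < β`, `(u + β)·b ≤ 1` on `[0,1]`, and a `ϖ`-free numerator `P ∈ ℚ[z₁, z₂]` (variables
`z 0 = z₁`, `z 1 = z₂`). If the open-square fibre integrals `∫_{(0,1)²} P/Q(·, ϖ)` vanish for all
`ϖ ∈ (0,b)`, then at every real-algebraic `ϖ₀ ∈ (0,b)` every tame cube representation of the fibre
`P/Q(·, ϖ₀)` is a Kontsevich–Zagier relation — the first proved sub-class whose Landau points are not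
rational over `ℚ(ϖ)`. The chain (all five links landed):

1. `stub_gpMoments` (p148399): every polynomial test function of `T = u(z₂) + βz₁` integrates to zero
   against `P`;
2. `stub_gpDensity` (p149184): on the top interval — `s ∈ (0,1)` with `u(1) − β < u(s)`, which holds near
   `s = 1` by continuity since `β > 0` — the single-branch pushforward identity
   `∫_{(s,1)} P((u(s) + β − u(σ))/β, σ) dσ = 0`;
3. `stub_gpPolyIntegral` (p148570): that single-branch integral is a polynomial `H(y, s)`, `y = u(s) + β`;
4. `stub_gpDivision` (p149192): infinitely many zeros of `H(u(s)+β, s)` + the factor theorem in `ℚ[s][y]`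
   give `P = u′(z₂)·∂₀M − β·∂₁M`, `M ∈ ℚ[z₁, z₂]`;
5. `stub_gpCertificate` (p148555): hence `P/Q = ∂₀(u′M/Q) + ∂₁(−βM/Q)` pointwise wherever `Q ≠ 0` —
   Griffiths exactness with denominator `Q` itself and NO scalar `c(ϖ)` (no walls);

and the fibre is closed by `stub_exactFibreTwo` (p138200: exactness at the fibre with `ℚ(ϖ₀)`-rational
data regular on the closed square + vanishing open-square integral ⇒ relation; Baker kills the
one-variable boundary), exactly as for the linear class `linClass_mem_relations` (p144073). Since the
certificate has no wall, the family-level wall mechanism `exactFamily_mem_relations` is not needed.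

References: Kontsevich–Zagier 2001, §1.2. Mathlib and the landed files above only (helper
`LinMoments.aeval_snoc_rename_castSucc` of `…StubLinMoments`, p141771); no named fact, no new definition.
Helpers live in the sub-namespace `GpClass`.
-/

noncomputable section

open MeasureTheory Set MvPolynomial
open Literature.NumberTheory.Transcendental

namespace Summit.KontsevichZagierPeriods.InverseLandau.TateFamilyKernel.Descent

namespace GpClass

/-! ### Evaluation of the graph-pencil data at a real point `(w, ϖ)` -/

/-- **The Tate denominator at a real point**: `Q(w, ϖ) = 1 − ϖ·(u(w₂) + β w₁)` for
`Q = 1 − X₂·(u(X₁) + β X₀)`. [folklore] -/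
theorem aeval_gpQ (u : Polynomial ℚ) (β : ℚ) (w : Fin 2 → ℝ) (ϖ : ℝ) :
    aeval (Fin.snoc w ϖ : Fin (2 + 1) → ℝ)
        (1 - X 2 * (Polynomial.aeval (X 1 : MvPolynomial (Fin (2 + 1)) ℚ) u + C β * X 0)) =
      1 - ϖ * (Polynomial.aeval (w 1) u + β * w 0) := by
  have h0 : (Fin.snoc w ϖ : Fin (2 + 1) → ℝ) 0 = w 0 := rfl
  have h1 : (Fin.snoc w ϖ : Fin (2 + 1) → ℝ) 1 = w 1 := rfl
  have h2 : (Fin.snoc w ϖ : Fin (2 + 1) → ℝ) 2 = ϖ := rfl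
  rw [map_sub, map_one, map_mul, map_add, map_mul, aeval_X, aeval_X, MvPolynomial.aeval_C,
    ← Polynomial.aeval_algHom_apply, aeval_X, h0, h1, h2, eq_ratCast]

/-- **The fibre integrand**, polynomial form versus real form:
`(rename castSucc P)/Q` at `(w, ϖ)` is `P(w)/(1 − ϖ(u(w₂) + βw₁))` (numerator:
`LinMoments.aeval_snoc_rename_castSucc`). [folklore] -/
theorem fibre_eq (u : Polynomial ℚ) (β : ℚ) (P : MvPolynomial (Fin 2) ℚ) (w : Fin 2 → ℝ) (ϖ : ℝ) :
    aeval (Fin.snoc w ϖ : Fin (2 + 1) → ℝ) (rename Fin.castSucc P) /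
        aeval (Fin.snoc w ϖ : Fin (2 + 1) → ℝ)
          (1 - X 2 * (Polynomial.aeval (X 1 : MvPolynomial (Fin (2 + 1)) ℚ) u + C β * X 0)) =
      aeval w P / (1 - ϖ * (Polynomial.aeval (w 1) u + β * w 0)) := by
  rw [LinMoments.aeval_snoc_rename_castSucc, aeval_gpQ]

/-! ### Admissibility: `Q > 0` on the closed square for `ϖ ∈ (0,b)` -/

/-- On the closed square, `0 < u(w₂) + βw₁` and `(u(w₂) + βw₁)·b ≤ 1`, so for `0 < ϖ < b` the Tate
denominator `1 − ϖ(u(w₂) + βw₁)` is positive. [folklore] -/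
theorem gpQ_pos {u : Polynomial ℚ} {β : ℚ} {b : ℝ} (hβ : 0 < β) (hb : 0 < b)
    (hu0 : ∀ s ∈ Icc (0 : ℝ) 1, 0 < Polynomial.aeval s u)
    (hub : ∀ s ∈ Icc (0 : ℝ) 1, (Polynomial.aeval s u + β) * b ≤ 1)
    {w : Fin 2 → ℝ} (hw : ∀ t, w t ∈ Icc (0 : ℝ) 1) {ϖ : ℝ} (hϖ : ϖ ∈ Ioo 0 b) :
    0 < 1 - ϖ * (Polynomial.aeval (w 1) u + β * w 0) := by
  have h0 := hw 0
  have hu := hu0 (w 1) (hw 1)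
  have hb1 := hub (w 1) (hw 1)
  have hβ' : (0 : ℝ) < β := by exact_mod_cast hβ
  have hT0 : 0 < Polynomial.aeval (w 1) u + (β : ℝ) * w 0 :=
    add_pos_of_pos_of_nonneg hu (mul_nonneg hβ'.le h0.1)
  have hTle : (Polynomial.aeval (w 1) u + (β : ℝ) * w 0) * b ≤ 1 := by
    have h2 : (β : ℝ) * w 0 ≤ β := mul_le_of_le_one_right hβ'.le h0.2
    have h3 : Polynomial.aeval (w 1) u + (β : ℝ) * w 0 ≤ Polynomial.aeval (w 1) u + β := by
      linarith
    exact (mul_le_mul_of_nonneg_right h3 hb.le).trans hb1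
  have hlt : ϖ * (Polynomial.aeval (w 1) u + (β : ℝ) * w 0) <
      b * (Polynomial.aeval (w 1) u + (β : ℝ) * w 0) := mul_lt_mul_of_pos_right hϖ.2 hT0
  nlinarith

/-- **The top interval.** For `0 < β` there is `s₁ ∈ [0, 1)` with `u(1) − β < u(s)` for all
`s ∈ (s₁, 1)` (continuity of the real polynomial function `u` at `1`). [folklore] -/
theorem exists_topInterval (u : Polynomial ℚ) {β : ℚ} (hβ : 0 < β) :
    ∃ s₁ : ℝ, 0 ≤ s₁ ∧ s₁ < 1 ∧
      ∀ s ∈ Ioo s₁ 1, Polynomial.aeval 1 u - (β : ℝ) < Polynomial.aeval s u := by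
  have hβ' : (0 : ℝ) < β := by exact_mod_cast hβ
  obtain ⟨δ, hδ, hδu⟩ := Metric.continuousAt_iff.1
    ((Polynomial.continuous_aeval u).continuousAt (x := (1 : ℝ))) β hβ'
  refine ⟨max 0 (1 - δ), le_max_left _ _, max_lt one_pos (by linarith), fun s hs => ?_⟩
  have hs1 : 1 - δ < s := (le_max_right _ _).trans_lt hs.1
  have hd : dist s 1 < δ := by
    rw [Real.dist_eq, abs_sub_comm, abs_of_pos (by linarith [hs.2])]
    linarith
  have h := hδu hd
  rw [Real.dist_eq] at h
  linarith [(abs_lt.1 h).1]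

end GpClass

open GpClass in
/-- **The graph-pencil class is a proved sector of the crux** (dimension 2): for `u ∈ ℚ[s]` positive and
strictly increasing on `[0,1]` of any degree and `β > 0`, every real-algebraic fibre of every identically
vanishing `P/(1 − ϖ(u(z₂)+βz₁))`, `P ∈ ℚ[z₁,z₂]`, is an effective KZ relation — the first proved
sub-class whose Landau points are not rational over `ℚ(ϖ)`; elimination by the factor theorem on the top
interval of the pushforward: `stub_gpMoments` → `stub_gpDensity` (top interval `(s₁,1)` by continuity of
`u` at `1`) → `stub_gpPolyIntegral` → `stub_gpDivision` (`P = u′∂₀M − β∂₁M`) → `stub_gpCertificate`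
(`P/Q = ∂₀(u′M/Q) + ∂₁(−βM/Q)`, no wall) → `stub_exactFibreTwo` at the fibre `ϖ₀` (Baker on the
boundary). [cite: KontsevichZagier2001, §1.2] -/
theorem gpClass_mem_relations (u : Polynomial ℚ) (β : ℚ) (P : MvPolynomial (Fin 2) ℚ) (b : ℝ) (hβ : 0 < β)
    (hb : 0 < b) (hu0 : ∀ s ∈ Icc (0 : ℝ) 1, 0 < Polynomial.aeval s u)
    (hmono : StrictMonoOn (fun s : ℝ => Polynomial.aeval s u) (Icc (0 : ℝ) 1))
    (hub : ∀ s ∈ Icc (0 : ℝ) 1, (Polynomial.aeval s u + β) * b ≤ 1)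
    (hvan : ∀ ϖ ∈ Ioo 0 b, ∫ z in Set.pi Set.univ (fun _ : Fin 2 => Ioo (0 : ℝ) 1),
      aeval z P / (1 - ϖ * (Polynomial.aeval (z 1) u + β * z 0)) = 0)
    (ϖ₀ : ℝ) (halg : IsAlgebraic ℚ ϖ₀) (hϖ₀ : ϖ₀ ∈ Ioo 0 b)
    (Φ : KZ.IntegralRep 2) (hΦ : Φ.IsTameCube)
    (hΦi : ∀ z ∈ KZ.cube 2, Φ.integrand z =
      aeval z P / (1 - ϖ₀ * (Polynomial.aeval (z 1) u + β * z 0))) :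
    KZ.of Φ ∈ KZ.relations := by
  -- (1) moments: every polynomial test function of `T = u(z₂) + βz₁` is orthogonal to `P`
  have htest := stub_gpMoments u β P b hβ hb hu0 hub hvan
  -- (2) the top interval `(s₁, 1)` and the single-branch pushforward identity on it
  obtain ⟨s₁, hs₁0, hs₁1, hs₁u⟩ := exists_topInterval u hβ
  have hden := stub_gpDensity u β P hβ hmono htest
  -- (3) the single-branch integral is a polynomial `H(y, s)`, vanishing at `y = u(s) + β` on `(s₁, 1)`
  obtain ⟨H, hH⟩ := stub_gpPolyIntegral u β P
  have hzero : ∀ s ∈ Ioo s₁ 1,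
      aeval (![Polynomial.aeval s u + β, s] : Fin 2 → ℝ) H = 0 := fun s hs => by
    rw [hH _ s hs.2.le]
    exact hden s ⟨hs₁0.trans_lt hs.1, hs.2⟩ (hs₁u s hs)
  -- (4) elimination: `P = u′(z₂)·∂₀M − β·∂₁M`
  obtain ⟨M, hM⟩ := stub_gpDivision u β P H hβ s₁ hs₁1 hH hzero
  -- (5) at the fibre `ϖ₀`: `Q ≠ 0` on the closed square and the two-term Griffiths certificate
  have hQ : ∀ w ∈ KZ.cube 2, aeval (Fin.snoc w ϖ₀ : Fin (2 + 1) → ℝ)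
      (1 - X 2 * (Polynomial.aeval (X 1 : MvPolynomial (Fin (2 + 1)) ℚ) u + C β * X 0)) ≠ 0 :=
    fun w hw => by
      rw [aeval_gpQ]
      exact (gpQ_pos hβ hb hu0 hub (fun t => hw t) hϖ₀).ne'
  have hcert := fun w (hw : w ∈ KZ.cube 2) => stub_gpCertificate u β P M hM ϖ₀ w (hQ w hw)
  -- (6) the vanishing open-square integral at `ϖ₀`, in polynomial form
  have hfun : (fun z : Fin 2 → ℝ => aeval (Fin.snoc z ϖ₀ : Fin (2 + 1) → ℝ) (rename Fin.castSucc P) /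
      aeval (Fin.snoc z ϖ₀ : Fin (2 + 1) → ℝ)
        (1 - X 2 * (Polynomial.aeval (X 1 : MvPolynomial (Fin (2 + 1)) ℚ) u + C β * X 0))) =
      fun z => aeval z P / (1 - ϖ₀ * (Polynomial.aeval (z 1) u + β * z 0)) :=
    funext fun z => fibre_eq u β P z ϖ₀
  have hvan' : ∫ z in Set.pi Set.univ (fun _ : Fin 2 => Ioo (0 : ℝ) 1),
      aeval (Fin.snoc z ϖ₀ : Fin (2 + 1) → ℝ) (rename Fin.castSucc P) /
        aeval (Fin.snoc z ϖ₀ : Fin (2 + 1) → ℝ)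
          (1 - X 2 * (Polynomial.aeval (X 1 : MvPolynomial (Fin (2 + 1)) ℚ) u + C β * X 0)) = 0 := by
    rw [hfun]
    exact hvan ϖ₀ hϖ₀
  -- exactness at the fibre suffices (`stub_exactFibreTwo`, Baker on the one-variable boundary)
  refine stub_exactFibreTwo 2 ![0, 1] (rename Fin.castSucc P)
    (1 - X 2 * (Polynomial.aeval (X 1 : MvPolynomial (Fin (2 + 1)) ℚ) u + C β * X 0))
    ![rename Fin.castSucc
        (Polynomial.aeval (X 1 : MvPolynomial (Fin 2) ℚ) (Polynomial.derivative u) * M),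
      rename Fin.castSucc (-(C β * M))]
    (fun _ => 1 - X 2 * (Polynomial.aeval (X 1 : MvPolynomial (Fin (2 + 1)) ℚ) u + C β * X 0))
    ϖ₀ halg hQ (fun _ => hQ) (fun w hw => ?_) hvan' Φ hΦ (fun z hz => ?_)
  · rw [Fin.sum_univ_two]
    simp only [Matrix.cons_val_zero, Matrix.cons_val_one, Fin.castSucc_zero, Fin.castSucc_one]
    exact hcert w hw
  · rw [hΦi z hz, fibre_eq]

open GpClass in
/-- The graph-pencil class in the crux's own binders (`n = 2`, open-square representation): an
identically vanishing family `P/(1 − ϖ(u(z₂) + βz₁))` as above has all its real-algebraic fibres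
`ϖ₀ ∈ (0,b)` in `KZ.relations` for every representation with domain the open square and integrand the
fibre there (tame-cube form `gpClass_mem_relations` + `exists_isTameCube_fibre` +
`of_mem_relations_of_isTameCube`). [cite: KontsevichZagier2001, §1.2] -/
theorem gpClass_openCube_mem_relations (u : Polynomial ℚ) (β : ℚ) (P : MvPolynomial (Fin 2) ℚ) (b : ℝ)
    (hβ : 0 < β) (hb : 0 < b) (hu0 : ∀ s ∈ Icc (0 : ℝ) 1, 0 < Polynomial.aeval s u)
    (hmono : StrictMonoOn (fun s : ℝ => Polynomial.aeval s u) (Icc (0 : ℝ) 1))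
    (hub : ∀ s ∈ Icc (0 : ℝ) 1, (Polynomial.aeval s u + β) * b ≤ 1)
    (hvan : ∀ ϖ ∈ Ioo 0 b, ∫ z in Set.pi Set.univ (fun _ : Fin 2 => Ioo (0 : ℝ) 1),
      aeval z P / (1 - ϖ * (Polynomial.aeval (z 1) u + β * z 0)) = 0)
    (ϖ₀ : ℝ) (halg : IsAlgebraic ℚ ϖ₀) (hϖ₀ : ϖ₀ ∈ Ioo 0 b)
    (r : KZ.IntegralRep 2) (hd : r.domain = Set.pi Set.univ (fun _ : Fin 2 => Ioo (0 : ℝ) 1))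
    (hi : EqOn r.integrand
      (fun z => aeval z P / (1 - ϖ₀ * (Polynomial.aeval (z 1) u + β * z 0))) r.domain) :
    KZ.of r ∈ KZ.relations := by
  have hQ : ∀ w ∈ KZ.cube 2, aeval (Fin.snoc w ϖ₀ : Fin (2 + 1) → ℝ)
      (1 - X 2 * (Polynomial.aeval (X 1 : MvPolynomial (Fin (2 + 1)) ℚ) u + C β * X 0)) ≠ 0 :=
    fun w hw => by
      rw [aeval_gpQ]
      exact (gpQ_pos hβ hb hu0 hub (fun t => hw t) hϖ₀).ne'
  obtain ⟨Φ, hΦ, hΦi⟩ := exists_isTameCube_fibre (rename Fin.castSucc P) _ halg hQ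
  have hΦrel : KZ.of Φ ∈ KZ.relations :=
    gpClass_mem_relations u β P b hβ hb hu0 hmono hub hvan ϖ₀ halg hϖ₀ Φ hΦ
      (fun z _ => by rw [hΦi]; exact fibre_eq u β P z ϖ₀)
  exact of_mem_relations_of_isTameCube hΦ hΦrel r hd
    (fun z hz => by rw [hΦi]; exact (hi hz).trans (fibre_eq u β P z ϖ₀).symm)

end Summit.KontsevichZagierPeriods.InverseLandau.TateFamilyKernel.Descent
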